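import Summits.Ventures.LatticeQCDFlow.Exactness.IMHGrandCouplingSplit
import Summits.Ventures.LatticeQCDFlow.Exactness.IMHColdStartPathMixture
import Summits.Ventures.LatticeQCDFlow.Scoring.ChainPathLaw
import HarnessLib

/-!
# The grand coupling on path space: every coordinate of the coupled simulation of a family of runs IS a run of the
# sampler, and after `b` shared updates ALL recorded streams are literally the same stream except with probability
# `r^b` — whatever the number of runs

HONEST FRAMING: exact (Metropolis-corrected) sampling algorithms for lattice gauge theory;
figures of merit are autocorrelation/cost numbers at stated couplings and volumes; no
continuum-physics claim.

Venture `LatticeQCDFlow` (cell pub-lqcd), topic `Exactness`; FANOUT row 30 (lean-1, GEN-36).  NEW WORK of the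
cell, general state space.  `Exactness/IMHGrandCoupling{,Split}` (this generation) built the common-random-numbers
kernel `K̂` of an arbitrary family `(x_i)_{i ∈ ι}` of runs of `K = indepMH q w` (`A = 1/w(x₀)`, `r = 1 − A`) and the
exact split `μ̂₀K̂ⁿ = (1 − rⁿ)·π̂ + rⁿ·μ̂₀R̂ⁿ`, `π̂` the constant lift of the target.  Here, as for pairs
(`Exactness/IMHCommonRandomNumbersPath`), the coupled SIMULATION `P̂_{μ̂₀}` (Mathlib's `Kernel.trajMeasure` of `K̂` on
`ℕ → (ι → Ω)`) is identified with what a practitioner running the family on one stream of random numbers records: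

* §1 **`crnFamily_chain_map_eval`** — EVERY COORDINATE OF THE COUPLED SIMULATION IS A RUN OF THE SAMPLER:
  `P̂_{μ̂₀} ∘ (ẑ ↦ (n ↦ ẑ n i))⁻¹ = P_{μ̂₀∘(eval i)⁻¹}`; **`crnFamily_chain_constLift`** — A CONSTANT START IS ONE RUN
  RECORDED ONCE PER INDEX: `P̂_{μ∘const⁻¹} = P_μ ∘ (x ↦ (n ↦ (i ↦ x n)))⁻¹`.
* §2 **`crnFamily_chain_shift_anyCoupling`** — FOR EVERY INITIAL COUPLING and every `b` (`w(x₀) > 1`):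
  `P̂_{μ̂₀} ∘ θ_b⁻¹ = (1 − r^b)·(P_π ∘ (x ↦ (n ↦ (i ↦ x n)))⁻¹) + r^b·P̂_{μ̂₀R̂^b}` EXACTLY;
  **`crnFamily_chain_shift_anyCoupling_exists`** — `R̂`-free form, `w(x₀) ≥ 1`;
  **`crnFamily_chain_shift_real_ge`** — `P̂(Ẑ_{b+·} ∈ S) ≥ (1 − r^b)·P_π{x : (n ↦ (i ↦ x n)) ∈ S}`.
* §3 for a countable family: **`crnFamily_chain_statistic_allEqual_ge`** — every measurable path statistic `F` takes
  ONE common value on all recorded streams, `P(F(Z_{b+·} i) = F(Z_{b+·} j) ∀ i j) ≥ 1 − r^b`;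
  **`crnFamily_chain_coincide_forever_ge`** (measurable diagonal) — `P(Z_{b+n} i = Z_{b+n} j ∀ n i j) ≥ 1 − r^b`:
  ALL RUNS COINCIDE FOREVER AFTER THE BURN-IN, except with probability `r^b`, independently of their number;
  **`crnFamily_chain_coincide_forever_ge_of_log_le`** — `log(1/δ) ≤ b·A` shared updates suffice for `≥ 1 − δ`.
Reading: `R` replicas of an exact flow sampler driven by ONE stream of proposals and uniforms are, after
`(1/A)·log(1/δ)` discarded updates, a single run written `R` times (probability `≥ 1 − δ`); replica spread under
shared random numbers measures the burn-in and nothing else.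
NOT CLAIMED: anything for uncountable families beyond measurable sets of family streams; the merging-time law.
No `sorry`, no new definitions, nothing cited as a fact.
-/

noncomputable section

namespace Summit.Ventures.LatticeQCDFlow.Exactness

open MeasureTheory ProbabilityTheory Function Set
open scoped ENNReal unitInterval
open Summit.Ventures.LatticeQCDFlow.Scoring Literature.Probability.MarkovChains

variable {Ω : Type*} [MeasurableSpace Ω] {q : Measure Ω} [IsProbabilityMeasure q] {w : Ω → ℝ} {ι : Type*}

/-! ## §1 Coordinates and constant starts -/

/-- **EVERY COORDINATE OF THE COUPLED SIMULATION IS A RUN OF THE SAMPLER**: the image of `P̂_{μ̂₀}` under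
`ẑ ↦ (n ↦ ẑ n i)` is the flow-MCMC path law from `μ̂₀∘(eval i)⁻¹`. [ours] -/
theorem crnFamily_chain_map_eval [Fact (Measurable w)] (hw0 : ∀ y, 0 < w y) (Khat : Kernel (ι → Ω) (ι → Ω))
    [IsMarkovKernel Khat]
    (hK : ∀ z : ι → Ω, Khat z = (q.prod (volume : Measure unitInterval)).map
      (fun p : Ω × unitInterval => fun i : ι => if (p.2 : ℝ) * w (z i) ≤ w p.1 then p.1 else z i))
    (μ₀ : Measure (ι → Ω)) [IsProbabilityMeasure μ₀] (i : ι) :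
    (Kernel.trajMeasure (X := fun _ : ℕ => ι → Ω) μ₀
        (fun n : ℕ => Khat.comap (fun h : (k : ↥(Finset.Iic n)) → (ι → Ω) => h ⟨n, Finset.mem_Iic.2 le_rfl⟩)
          (measurable_pi_apply _))).map (fun (z : ℕ → ι → Ω) (n : ℕ) => z n i) =
      Kernel.trajMeasure (X := fun _ : ℕ => Ω) (μ₀.map (fun x : ι → Ω => x i))
        (fun n : ℕ => (indepMH q w).comap (fun h : (k : ↥(Finset.Iic n)) → Ω => h ⟨n, Finset.mem_Iic.2 le_rfl⟩)
          (measurable_pi_apply _)) :=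
  chain_map_of_intertwining (indepMH q w) Khat μ₀ (measurable_pi_apply i)
    (crnFamily_map_eval Fact.out hw0 Khat hK · i)

/-- **A CONSTANT START IS ONE RUN RECORDED ONCE PER INDEX**: the family chain started from the constant lift of `μ`
is the image of the run from `μ` under `x ↦ (n ↦ (i ↦ x n))`. [ours] -/
theorem crnFamily_chain_constLift [Fact (Measurable w)] (hw0 : ∀ y, 0 < w y) (Khat : Kernel (ι → Ω) (ι → Ω))
    [IsMarkovKernel Khat]
    (hK : ∀ z : ι → Ω, Khat z = (q.prod (volume : Measure unitInterval)).map
      (fun p : Ω × unitInterval => fun i : ι => if (p.2 : ℝ) * w (z i) ≤ w p.1 then p.1 else z i))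
    (μ : Measure Ω) [IsProbabilityMeasure μ] :
    Kernel.trajMeasure (X := fun _ : ℕ => ι → Ω) (μ.map (fun (y : Ω) (_ : ι) => y))
        (fun n : ℕ => Khat.comap (fun h : (k : ↥(Finset.Iic n)) → (ι → Ω) => h ⟨n, Finset.mem_Iic.2 le_rfl⟩)
          (measurable_pi_apply _)) =
      (Kernel.trajMeasure (X := fun _ : ℕ => Ω) μ
        (fun n : ℕ => (indepMH q w).comap (fun h : (k : ↥(Finset.Iic n)) → Ω => h ⟨n, Finset.mem_Iic.2 le_rfl⟩)
          (measurable_pi_apply _))).map (fun (x : ℕ → Ω) (n : ℕ) (_ : ι) => x n) :=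
  (chain_map_of_intertwining Khat (indepMH q w) μ (measurable_pi_lambda _ fun _ => measurable_id)
    (fun x => (crnFamily_const_apply Fact.out hw0 Khat hK x).symm)).symm

/-! ## §2 The family stream after `b` shared updates -/

/-- **THE FAMILY PATH LAW AFTER `b` SHARED UPDATES, FROM EVERY INITIAL COUPLING** (`w(x₀) > 1`):
`P̂_{μ̂₀} ∘ θ_b⁻¹ = (1 − r^b)·(P_π ∘ (x ↦ (n ↦ (i ↦ x n)))⁻¹) + r^b·P̂_{μ̂₀R̂^b}`. [ours] -/
theorem crnFamily_chain_shift_anyCoupling [Fact (Measurable w)] (hw0 : ∀ y, 0 < w y) {x₀ : Ω}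
    (hmax : ∀ y, w y ≤ w x₀) (hlt : 1 < w x₀) [IsProbabilityMeasure (q.withDensity fun y => ENNReal.ofReal (w y))]
    (Khat : Kernel (ι → Ω) (ι → Ω)) [IsMarkovKernel Khat]
    (hK : ∀ z : ι → Ω, Khat z = (q.prod (volume : Measure unitInterval)).map
      (fun p : Ω × unitInterval => fun i : ι => if (p.2 : ℝ) * w (z i) ≤ w p.1 then p.1 else z i))
    (μ₀ : Measure (ι → Ω)) [IsProbabilityMeasure μ₀] (b : ℕ) :
    (Kernel.trajMeasure (X := fun _ : ℕ => ι → Ω) μ₀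
        (fun n : ℕ => Khat.comap (fun h : (k : ↥(Finset.Iic n)) → (ι → Ω) => h ⟨n, Finset.mem_Iic.2 le_rfl⟩)
          (measurable_pi_apply _))).map (fun (z : ℕ → ι → Ω) (n : ℕ) => z (b + n)) =
      ENNReal.ofReal (1 - (1 - (w x₀)⁻¹) ^ b) •
          (Kernel.trajMeasure (X := fun _ : ℕ => Ω) (q.withDensity fun y => ENNReal.ofReal (w y))
            (fun n : ℕ => (indepMH q w).comap (fun h : (k : ↥(Finset.Iic n)) → Ω => h ⟨n, Finset.mem_Iic.2 le_rfl⟩)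
              (measurable_pi_apply _))).map (fun (x : ℕ → Ω) (n : ℕ) (_ : ι) => x n) +
        ENNReal.ofReal ((1 - (w x₀)⁻¹) ^ b) •
          Kernel.trajMeasure (X := fun _ : ℕ => ι → Ω)
            ((fun m : Measure (ι → Ω) => m.bind
              (@Doeblin.residualKernel (ι → Ω) _ Khat _ ((q.withDensity fun y => ENNReal.ofReal (w y)).map
                (fun (y : Ω) (_ : ι) => y)) (isProbabilityMeasure_constLift _) (ENNReal.ofReal (w x₀)⁻¹)
                (crnFamily_minorised Fact.out hw0 hmax Khat hK)))^[b] μ₀)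
            (fun n : ℕ => Khat.comap (fun h : (k : ↥(Finset.Iic n)) → (ι → Ω) => h ⟨n, Finset.mem_Iic.2 le_rfl⟩)
              (measurable_pi_apply _)) := by
  rw [chain_map_shift_eq Khat μ₀ b, iterate_bind_crnFamily_eq_residual_mixture Fact.out hw0 hmax hlt Khat hK b μ₀,
    chain_add_smul, crnFamily_chain_constLift hw0 Khat hK]

/-- **`R̂`-free form, every `w(x₀) ≥ 1`.** [ours] -/
theorem crnFamily_chain_shift_anyCoupling_exists [Fact (Measurable w)] (hw0 : ∀ y, 0 < w y) {x₀ : Ω}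
    (hmax : ∀ y, w y ≤ w x₀) [IsProbabilityMeasure (q.withDensity fun y => ENNReal.ofReal (w y))]
    (Khat : Kernel (ι → Ω) (ι → Ω)) [IsMarkovKernel Khat]
    (hK : ∀ z : ι → Ω, Khat z = (q.prod (volume : Measure unitInterval)).map
      (fun p : Ω × unitInterval => fun i : ι => if (p.2 : ℝ) * w (z i) ≤ w p.1 then p.1 else z i))
    (μ₀ : Measure (ι → Ω)) [IsProbabilityMeasure μ₀] (b : ℕ) :
    ∃ ν : Measure (ι → Ω), IsProbabilityMeasure ν ∧
      (Kernel.trajMeasure (X := fun _ : ℕ => ι → Ω) μ₀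
          (fun n : ℕ => Khat.comap (fun h : (k : ↥(Finset.Iic n)) → (ι → Ω) => h ⟨n, Finset.mem_Iic.2 le_rfl⟩)
            (measurable_pi_apply _))).map (fun (z : ℕ → ι → Ω) (n : ℕ) => z (b + n)) =
        ENNReal.ofReal (1 - (1 - (w x₀)⁻¹) ^ b) •
            (Kernel.trajMeasure (X := fun _ : ℕ => Ω) (q.withDensity fun y => ENNReal.ofReal (w y))
              (fun n : ℕ => (indepMH q w).comap (fun h : (k : ↥(Finset.Iic n)) → Ω => h ⟨n, Finset.mem_Iic.2 le_rfl⟩)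
                (measurable_pi_apply _))).map (fun (x : ℕ → Ω) (n : ℕ) (_ : ι) => x n) +
          ENNReal.ofReal ((1 - (w x₀)⁻¹) ^ b) •
            Kernel.trajMeasure (X := fun _ : ℕ => ι → Ω) ν
              (fun n : ℕ => Khat.comap (fun h : (k : ↥(Finset.Iic n)) → (ι → Ω) => h ⟨n, Finset.mem_Iic.2 le_rfl⟩)
                (measurable_pi_apply _)) := by
  obtain ⟨ν, hν, h⟩ := exists_iterate_bind_crnFamily_eq_mixture (q := q) Fact.out hw0 hmax Khat hK b μ₀
  refine ⟨ν, hν, ?_⟩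
  rw [chain_map_shift_eq Khat μ₀ b, h, chain_add_smul, crnFamily_chain_constLift hw0 Khat hK]

/-- **THE LOWER ENVELOPE ON FAMILY STREAMS**: `P̂_{μ̂₀}(Ẑ_{b+·} ∈ S) ≥ (1 − r^b)·P_π{x : (n ↦ (i ↦ x n)) ∈ S}` for every
measurable set `S` of family streams and every initial coupling. [ours] -/
theorem crnFamily_chain_shift_real_ge [Fact (Measurable w)] (hw0 : ∀ y, 0 < w y) {x₀ : Ω} (hmax : ∀ y, w y ≤ w x₀)
    [IsProbabilityMeasure (q.withDensity fun y => ENNReal.ofReal (w y))]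
    (Khat : Kernel (ι → Ω) (ι → Ω)) [IsMarkovKernel Khat]
    (hK : ∀ z : ι → Ω, Khat z = (q.prod (volume : Measure unitInterval)).map
      (fun p : Ω × unitInterval => fun i : ι => if (p.2 : ℝ) * w (z i) ≤ w p.1 then p.1 else z i))
    (μ₀ : Measure (ι → Ω)) [IsProbabilityMeasure μ₀] (b : ℕ) {S : Set (ℕ → ι → Ω)} (hS : MeasurableSet S) :
    (1 - (1 - (w x₀)⁻¹) ^ b) *
        (Kernel.trajMeasure (X := fun _ : ℕ => Ω) (q.withDensity fun y => ENNReal.ofReal (w y))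
          (fun n : ℕ => (indepMH q w).comap (fun h : (k : ↥(Finset.Iic n)) → Ω => h ⟨n, Finset.mem_Iic.2 le_rfl⟩)
            (measurable_pi_apply _))).real {x | (fun (n : ℕ) (_ : ι) => x n) ∈ S} ≤
      (Kernel.trajMeasure (X := fun _ : ℕ => ι → Ω) μ₀
        (fun n : ℕ => Khat.comap (fun h : (k : ↥(Finset.Iic n)) → (ι → Ω) => h ⟨n, Finset.mem_Iic.2 le_rfl⟩)
          (measurable_pi_apply _))).real {z | (fun n => z (b + n)) ∈ S} := by
  obtain ⟨ν, hν, h⟩ := crnFamily_chain_shift_anyCoupling_exists hw0 hmax Khat hK μ₀ b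
  have hΘ : Measurable (fun (z : ℕ → ι → Ω) (n : ℕ) => z (b + n)) :=
    measurable_pi_lambda _ fun n => measurable_pi_apply _
  have hD : Measurable (fun (x : ℕ → Ω) (n : ℕ) (_ : ι) => x n) :=
    measurable_pi_lambda _ fun n => measurable_pi_lambda _ fun _ => measurable_pi_apply n
  have hW : 1 ≤ w x₀ := one_le_of_mode (q := q) hmax
  have hr0 : 0 ≤ 1 - (w x₀)⁻¹ := sub_nonneg.2 (inv_le_one_of_one_le₀ hW)
  have hr1 : 1 - (w x₀)⁻¹ ≤ 1 := sub_le_self _ (inv_nonneg.mpr (hw0 x₀).le)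
  have hc0 : 0 ≤ 1 - (1 - (w x₀)⁻¹) ^ b := sub_nonneg.2 (pow_le_one₀ hr0 hr1)
  have hpre := map_measureReal_apply hΘ hS (μ := Kernel.trajMeasure (X := fun _ : ℕ => ι → Ω) μ₀
        (fun n : ℕ => Khat.comap (fun h : (k : ↥(Finset.Iic n)) → (ι → Ω) => h ⟨n, Finset.mem_Iic.2 le_rfl⟩)
          (measurable_pi_apply _)))
  rw [show (fun (z : ℕ → ι → Ω) (n : ℕ) => z (b + n)) ⁻¹' S = {z | (fun n => z (b + n)) ∈ S} from rfl] at hpre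
  rw [← hpre, h]
  simp only [measureReal_def, Measure.add_apply, Measure.smul_apply, smul_eq_mul, Measure.map_apply hD hS]
  rw [ENNReal.toReal_add (ENNReal.mul_ne_top ENNReal.ofReal_ne_top (measure_ne_top _ _))
      (ENNReal.mul_ne_top ENNReal.ofReal_ne_top (measure_ne_top _ _)), ENNReal.toReal_mul,
    ENNReal.toReal_ofReal hc0]
  exact le_add_of_nonneg_right ENNReal.toReal_nonneg

/-! ## §3 Countable families: one common stream -/

/-- **EVERY PATH STATISTIC TAKES ONE COMMON VALUE ON ALL RECORDED STREAMS** (countable family, any measurable space):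
`P(F(Z_{b+·} i) = F(Z_{b+·} j) for all i, j) ≥ 1 − r^b`. [ours] -/
theorem crnFamily_chain_statistic_allEqual_ge [Countable ι] [Fact (Measurable w)] (hw0 : ∀ y, 0 < w y) {x₀ : Ω}
    (hmax : ∀ y, w y ≤ w x₀) [IsProbabilityMeasure (q.withDensity fun y => ENNReal.ofReal (w y))]
    (Khat : Kernel (ι → Ω) (ι → Ω)) [IsMarkovKernel Khat]
    (hK : ∀ z : ι → Ω, Khat z = (q.prod (volume : Measure unitInterval)).map
      (fun p : Ω × unitInterval => fun i : ι => if (p.2 : ℝ) * w (z i) ≤ w p.1 then p.1 else z i))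
    (μ₀ : Measure (ι → Ω)) [IsProbabilityMeasure μ₀] (b : ℕ) {F : (ℕ → Ω) → ℝ} (hF : Measurable F) :
    1 - (1 - (w x₀)⁻¹) ^ b ≤
      (Kernel.trajMeasure (X := fun _ : ℕ => ι → Ω) μ₀
        (fun n : ℕ => Khat.comap (fun h : (k : ↥(Finset.Iic n)) → (ι → Ω) => h ⟨n, Finset.mem_Iic.2 le_rfl⟩)
          (measurable_pi_apply _))).real
        {z | ∀ i j, F (fun n => z (b + n) i) = F (fun n => z (b + n) j)} := by
  have hco : ∀ i : ι, Measurable (fun (z : ℕ → ι → Ω) => F (fun n => z n i)) := fun i =>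
    hF.comp (measurable_pi_lambda _ fun n => (measurable_pi_apply i).comp (measurable_pi_apply n))
  have hS : MeasurableSet {z : ℕ → ι → Ω | ∀ i j, F (fun n => z n i) = F (fun n => z n j)} := by
    have : {z : ℕ → ι → Ω | ∀ i j, F (fun n => z n i) = F (fun n => z n j)} =
        ⋂ i, ⋂ j, {z : ℕ → ι → Ω | F (fun n => z n i) = F (fun n => z n j)} := by
      ext z; simp
    rw [this]
    exact MeasurableSet.iInter fun i => MeasurableSet.iInter fun j => measurableSet_eq_fun (hco i) (hco j)
  have h := crnFamily_chain_shift_real_ge hw0 hmax Khat hK μ₀ b hS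
  have hset : {x : ℕ → Ω | (fun (n : ℕ) (_ : ι) => x n) ∈
      {z : ℕ → ι → Ω | ∀ i j, F (fun n => z n i) = F (fun n => z n j)}} = univ := by
    ext x; simp
  rw [hset, probReal_univ, mul_one] at h
  exact h

/-- **ALL RUNS COINCIDE FOREVER AFTER THE BURN-IN, WHATEVER THEIR NUMBER** (countable family, measurable diagonal):
`P(Z_{b+n} i = Z_{b+n} j for all n, i, j) ≥ 1 − r^b`, from every initial coupling. [ours] -/
theorem crnFamily_chain_coincide_forever_ge [Countable ι] [MeasurableEq Ω] [Fact (Measurable w)]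
    (hw0 : ∀ y, 0 < w y) {x₀ : Ω} (hmax : ∀ y, w y ≤ w x₀)
    [IsProbabilityMeasure (q.withDensity fun y => ENNReal.ofReal (w y))]
    (Khat : Kernel (ι → Ω) (ι → Ω)) [IsMarkovKernel Khat]
    (hK : ∀ z : ι → Ω, Khat z = (q.prod (volume : Measure unitInterval)).map
      (fun p : Ω × unitInterval => fun i : ι => if (p.2 : ℝ) * w (z i) ≤ w p.1 then p.1 else z i))
    (μ₀ : Measure (ι → Ω)) [IsProbabilityMeasure μ₀] (b : ℕ) :
    1 - (1 - (w x₀)⁻¹) ^ b ≤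
      (Kernel.trajMeasure (X := fun _ : ℕ => ι → Ω) μ₀
        (fun n : ℕ => Khat.comap (fun h : (k : ↥(Finset.Iic n)) → (ι → Ω) => h ⟨n, Finset.mem_Iic.2 le_rfl⟩)
          (measurable_pi_apply _))).real {z | ∀ n i j, z (b + n) i = z (b + n) j} := by
  have hS : MeasurableSet {z : ℕ → ι → Ω | ∀ n i j, z n i = z n j} := by
    have : {z : ℕ → ι → Ω | ∀ n i j, z n i = z n j} =
        ⋂ n, ⋂ i, ⋂ j, {z : ℕ → ι → Ω | z n i = z n j} := by
      ext z; simp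
    rw [this]
    exact MeasurableSet.iInter fun n => MeasurableSet.iInter fun i => MeasurableSet.iInter fun j =>
      measurableSet_eq_fun ((measurable_pi_apply i).comp (measurable_pi_apply n))
        ((measurable_pi_apply j).comp (measurable_pi_apply n))
  have h := crnFamily_chain_shift_real_ge hw0 hmax Khat hK μ₀ b hS
  have hset : {x : ℕ → Ω | (fun (n : ℕ) (_ : ι) => x n) ∈ {z : ℕ → ι → Ω | ∀ n i j, z n i = z n j}} = univ := by
    ext x; simp
  rw [hset, probReal_univ, mul_one] at h
  exact h

/-- **`log(1/δ) ≤ b·A` SHARED UPDATES MAKE ALL RUNS OF THE FAMILY COINCIDE FOREVER WITH PROBABILITY `≥ 1 − δ`**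
(countable family, measurable diagonal) — the number of runs does not enter. [ours] -/
theorem crnFamily_chain_coincide_forever_ge_of_log_le [Countable ι] [MeasurableEq Ω] [Fact (Measurable w)]
    (hw0 : ∀ y, 0 < w y) {x₀ : Ω} (hmax : ∀ y, w y ≤ w x₀)
    [IsProbabilityMeasure (q.withDensity fun y => ENNReal.ofReal (w y))]
    (Khat : Kernel (ι → Ω) (ι → Ω)) [IsMarkovKernel Khat]
    (hK : ∀ z : ι → Ω, Khat z = (q.prod (volume : Measure unitInterval)).map
      (fun p : Ω × unitInterval => fun i : ι => if (p.2 : ℝ) * w (z i) ≤ w p.1 then p.1 else z i))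
    (μ₀ : Measure (ι → Ω)) [IsProbabilityMeasure μ₀] (b : ℕ) {δ : ℝ} (hδ : 0 < δ)
    (hb : Real.log (1 / δ) ≤ b * (w x₀)⁻¹) :
    1 - δ ≤
      (Kernel.trajMeasure (X := fun _ : ℕ => ι → Ω) μ₀
        (fun n : ℕ => Khat.comap (fun h : (k : ↥(Finset.Iic n)) → (ι → Ω) => h ⟨n, Finset.mem_Iic.2 le_rfl⟩)
          (measurable_pi_apply _))).real {z | ∀ n i j, z (b + n) i = z (b + n) j} := by
  have h := crnFamily_chain_coincide_forever_ge hw0 hmax Khat hK μ₀ b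
  have hW : 1 ≤ w x₀ := one_le_of_mode (q := q) hmax
  have hr0 : 0 ≤ 1 - (w x₀)⁻¹ := sub_nonneg.2 (inv_le_one_of_one_le₀ hW)
  have hrb : (1 - (w x₀)⁻¹) ^ b ≤ δ := by
    calc (1 - (w x₀)⁻¹) ^ b ≤ Real.exp (-(w x₀)⁻¹) ^ b := by
          gcongr
          have := Real.add_one_le_exp (-(w x₀)⁻¹)
          linarith
      _ = Real.exp (-(b * (w x₀)⁻¹)) := by rw [← Real.exp_nat_mul]; ring_nf
      _ ≤ Real.exp (-Real.log (1 / δ)) := Real.exp_le_exp.2 (neg_le_neg hb)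
      _ = δ := by rw [Real.exp_neg, Real.exp_log (by positivity), one_div, inv_inv]
  linarith

end Summit.Ventures.LatticeQCDFlow.Exactness

end
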